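import Literature.MathematicalPhysics.QuantumFieldTheory.Balaban1983to89.T4EntropyShapeInstances
import Literature.MathematicalPhysics.QuantumFieldTheory.Balaban1983to89.T4PartnerMultiplicity
import Literature.MathematicalPhysics.QuantumFieldTheory.Balaban1983to89.B16Absorption

/-!
# Balaban T⁴ spine, estimate NE7b (node U5c, COUNT member P1): PARTNER PLACEMENT — the geometric inputs of the
# merger-multiplicity wall (GM) in the cell's ℤᵈ index model

Cell `pub-balaban`, lineage `b2b-balaban-t4-ne7b-p1` (generation 18), self-row `T4-U5c.E-NE7b-GM-K*`; GAPS
G-ne7bp1g12-1 (GM).  Summits-side NEW WORK (LEAN PLACEMENT RULE 2026-08-19): tree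
`Summits/QuantumFields/BalabanUV/T4Continuum/Support/PartnerPlacement.lean`, namespace
`Summit.QuantumFields.BalabanUV.T4Continuum.PartnerPlacement`; imports BY NAME the frozen Literature-side index model
(`B13ScaleTransfer.{Pt, coarse, collar, closureIdx}`, `B16SProfile.{box, Siter, Qprod, ratio, DropCtl}`,
`B16Absorption.{box_subset_iterate_collar, ratio_const, dropCtl_const}`, `T4EntropyShapeInstances.{zone, siteConst,
card_zone_le}`, `T4PartnerMultiplicity.partnerAges`) and modifies nothing.

HONEST FRAMING.  Rung (B)+1 of the FINITE-VOLUME T⁴ continuum programme: finite combinatorics on `ℤᵈ` in the cell's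
OWN index model of the blocking maps.  NOT infinite volume, NOT a mass gap, NOT the Clay problem, NOT a proof of NE7b;
nothing of Bałaban's expansion is asserted; `BetaPertH` / (B) / (B^μ) are not involved.  HONEST DEPENDENCY (cell,
verbatim): continuum YM on T⁴ ⇐ BetaPertH ∧ nine spine estimates (0/9 proved); BetaPertH ⇐ (D1) ∧ (D4) ∧ CAP+tail;
G-an2-4 gates asym, D1 and NE2/3/4.

THE WALL (GM) (GAPS G-ne7bp1g12-1, the labelling binder `hlabM` of `T4PartnerMultiplicity`): summed over the admissible
positionings of a genealogy's events, the raw price is at most `c^{#events} · Λ′^{partnerAges} · e^{−credits} ·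
e^{+lifeCost}`; its geometric half reads «at a merger performed at step `m`, the LATER-born partner (born at `s′ ≤ m`)
has its birth cell among `≤ c · Λ′^{m+1−s′}` cells under the merger block».  THIS MODULE kernel-closes the geometric
half for ONE merger, in the index model, with every factor displayed:
* §1 FIBRES OF THE BLOCKING MAP `x ↦ ⌊x/Q⌋` (`coarse Q`): `blockFibre Q b` has exactly `Q^d` cubes (`card_blockFibre`),
  fibres are disjoint, `#(coarse Q)⁻¹(B) = Q^d · #B` (`card_blockFibres`), and TWO BLOCKINGS ARE ONE
  (`blockFibres_blockFibres`: `(coarse a)⁻¹((coarse b)⁻¹ B) = (coarse (a·b))⁻¹ B`, from `B16SProfile.coarse_coarse`).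
* §2 TRANSLATED SHAPES: the root cells `c` of a pattern `S` one of whose cubes `c + v` blocks into `A` number
  `≤ #S · Q^d · #A` (`card_placements_le`).
* §3 TOUCHING THROUGH THE S-OPERATION: if `S^{a}(P)` meets a target `T` on the step-`a` lattice then some cube of `P`
  blocks into `collar^[31] T` (`exists_coarse_mem_of_Siter_meets`, from `B16SProfile.Siter_subset_biUnion_box`: every
  cube of `S^{a}(P)` lies within sup-distance `31` of the image of a cube of `P`; `L ≥ 3`, drop control); hence the
  touching placements of a pattern number `≤ #S · Q_a^d · #collar^[31] T` (`card_touching_le`; merger-trigger form with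
  `B16MergeGeometry.Touch`: `card_touchingT_le`; a covered target piece by piece: `card_iterate_collar_le_sum`), and for a ZONE
  `(S^{i}(Z))^{~r}` of `T4EntropyShapeInstances` the `31` extra layers are absorbed by `zone (r+31)` (`iterate_collar_zone`),
  so `card_zone_le` prices the target: `≤ #S · Q_a^d · siteConst d (31+r) · (1 + d′(Z)·2^{−i})` (`card_touching_zone_le`).
* §4 THE EXPONENT, EXACTLY: `Q_a^d · (R_0)^d = Λ^a · (R_a)^d` with `Λ = L^d`, `R_n = L^{σ n}` (`Qprod_pow_mul`, from
  `B16SProfile.Qprod_ratio_mul_pow`); so `Q_a^d ≤ Λ^a · R_a^d` always (`Qprod_pow_le`), `Q_a^d ≤ Λ^a` when the size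
  exponent did not grow (`Qprod_pow_le_of_le`), and `Q_a^d = Λ^a` ON THE NOSE in the uniform cell model `σ ≡ const` of
  `T4PersistentHistoryCount.card_torusCells` (`Qprod_pow_const`).  LOCATED EXCESS (displayed, not hidden): in general the
  partner fibre carries `(R_m/R_{s′})^d ≥ 1` beyond `Λ^{age}`; it is NOT a constant under the typed flow and is NOT paid
  by the window surplus — it belongs to the partner's `p₀`-birth credit / the `(1+o(1))` of the survival condition, i.e.
  to the (E2)/(ID) owners (GAPS G-ne7bp1-1, G-ne7bp1g9-1), not to this leaf.
* §5 PATH INDEPENDENCE `Q_{a+b} = Q_a · Q′_b` (`Qprod_add`; `Q′` the shifted ratios): the total fibre factor of a chain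
  of re-rootings depends only on its endpoints — the seed of the positioned-genealogy assembly (NEXT row, GM-ASSEMBLY).
* §6 the per-merger exponent of `T4PartnerMultiplicity.partnerAges` is the `a + 1` of §3–§4 with `a = m − s′`
  (`partnerAges_merge_born`), and decided sanity instances.

NOT CLOSED HERE: the assembly over positioned genealogies (products of §3 along `Gen.merge`, re-rooting by §5; which
piece touches is the reading (ID) G-ne7bp1g9-1) and the analytic price (E2)/(R1) G-ne7bp1-1.

ABSOLUTE RULE.  No internally-minted statement enters as a cited fact: 0 `[cite:]` tags, every hypothesis of every
theorem is a displayed binder, every declaration is [folklore] finite combinatorics, sorry-free, with the standard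
axioms only, over the EXISTING definitions; the manuscripts under audit ([Balaban1989LargeFieldII] (1.80)–(1.86) pp. 384–386: the operation
`S`, the `(63)^d` cover, the merger of touching domains) appear in docstrings as CONTEXT only, never as facts.
-/

namespace Summit.QuantumFields.BalabanUV.T4Continuum.PartnerPlacement

open Finset
open Literature.MathematicalPhysics.QuantumFieldTheory.Balaban1983to89
open B13ScaleTransfer B16SProfile B16Absorption TreeLength T4EntropyShapeInstances
open T4PersistenceDictionary T4PartnerMultiplicity

noncomputable section

variable {d : ℕ}

/-! ## §1 Fibres of the blocking map -/

/-- **THE FIBRE OF THE BLOCKING MAP** over the coarse cube `b`: the fine cubes `x` with `⌊x/Q⌋ = b`, i.e.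
`Q·b_i ≤ x_i < Q·b_i + Q` in every direction (print's «cubes of side L (in π_k units) partitioning the lattice»,
`B13ScaleTransfer.coarse_eq_iff`). [folklore] -/
def blockFibre (Q : ℕ) (b : Pt d) : Finset (Pt d) :=
  Fintype.piFinset fun i => Finset.Ico ((Q : ℤ) * b i) ((Q : ℤ) * b i + Q)

/-- Membership: `x ∈ blockFibre Q b ↔ coarse Q x = b`. [folklore] -/
theorem mem_blockFibre {Q : ℕ} (hQ : 0 < Q) {b x : Pt d} : x ∈ blockFibre Q b ↔ coarse Q x = b := by
  rw [coarse_eq_iff hQ x b]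
  simp only [blockFibre, Fintype.mem_piFinset, Finset.mem_Ico, mul_add, mul_one]

/-- **A FIBRE HAS EXACTLY `Q^d` CUBES.** [folklore] -/
theorem card_blockFibre (Q : ℕ) (b : Pt d) : (blockFibre Q b).card = Q ^ d := by
  unfold blockFibre
  rw [Fintype.card_piFinset]
  simp

/-- Distinct coarse cubes have disjoint fibres. [folklore] -/
theorem pairwiseDisjoint_blockFibre {Q : ℕ} (hQ : 0 < Q) (B : Finset (Pt d)) :
    (B : Set (Pt d)).PairwiseDisjoint (blockFibre Q) := by
  intro b _ b' _ hne
  rw [Function.onFun, Finset.disjoint_left]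
  intro x hx hx'
  exact hne (((mem_blockFibre hQ).1 hx).symm.trans ((mem_blockFibre hQ).1 hx'))

/-- **THE PREIMAGE OF A SET OF COARSE CUBES** `(coarse Q)⁻¹(B)` as a finite set. [folklore] -/
def blockFibres (Q : ℕ) (B : Finset (Pt d)) : Finset (Pt d) := B.biUnion (blockFibre Q)

/-- Membership: `x ∈ blockFibres Q B ↔ coarse Q x ∈ B`. [folklore] -/
theorem mem_blockFibres {Q : ℕ} (hQ : 0 < Q) {B : Finset (Pt d)} {x : Pt d} :
    x ∈ blockFibres Q B ↔ coarse Q x ∈ B := by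
  constructor
  · intro h
    obtain ⟨b, hb, hx⟩ := Finset.mem_biUnion.1 h
    rwa [(mem_blockFibre hQ).1 hx]
  · intro h
    exact Finset.mem_biUnion.2 ⟨_, h, (mem_blockFibre hQ).2 rfl⟩

/-- **`#(coarse Q)⁻¹(B) = Q^d · #B`.** [folklore] -/
theorem card_blockFibres {Q : ℕ} (hQ : 0 < Q) (B : Finset (Pt d)) : (blockFibres Q B).card = Q ^ d * B.card := by
  unfold blockFibres
  rw [Finset.card_biUnion (pairwiseDisjoint_blockFibre hQ B)]
  simp [card_blockFibre, Finset.sum_const, mul_comm]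

/-- Filter form: in ANY finite universe `U` of fine cubes, those blocking into `B` number `≤ Q^d · #B`. [folklore] -/
theorem card_filter_coarse_mem_le {Q : ℕ} (hQ : 0 < Q) (U B : Finset (Pt d)) :
    (U.filter fun x => coarse Q x ∈ B).card ≤ Q ^ d * B.card := by
  rw [← card_blockFibres hQ B]
  exact Finset.card_le_card fun x hx => (mem_blockFibres hQ).2 (Finset.mem_filter.1 hx).2

/-- **TWO BLOCKINGS ARE ONE**: `(coarse a)⁻¹((coarse b)⁻¹(B)) = (coarse (a·b))⁻¹(B)` (`B16SProfile.coarse_coarse`) — the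
fibre of a composite blocking is the fibre of the product ratio; with `card_blockFibres`, `a^d · (b^d · #B) = (ab)^d · #B`.
[folklore] -/
theorem blockFibres_blockFibres {a b : ℕ} (ha : 0 < a) (hb : 0 < b) (B : Finset (Pt d)) :
    blockFibres a (blockFibres b B) = blockFibres (a * b) B := by
  ext x
  rw [mem_blockFibres ha, mem_blockFibres hb, mem_blockFibres (Nat.mul_pos ha hb), coarse_coarse]

/-! ## §2 Translated shapes -/

/-- **PLACEMENTS OF A PATTERN**: the root cells `c` such that some cube `c + v` of the translated pattern `c + S` blocks
into `A` under `coarse Q`. [folklore] -/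
def placements (Q : ℕ) (S A : Finset (Pt d)) : Finset (Pt d) :=
  S.biUnion fun v => (blockFibres Q A).image fun x => x - v

/-- Membership: `c ∈ placements Q S A ↔ ∃ v ∈ S, coarse Q (c + v) ∈ A`. [folklore] -/
theorem mem_placements {Q : ℕ} (hQ : 0 < Q) {S A : Finset (Pt d)} {c : Pt d} :
    c ∈ placements Q S A ↔ ∃ v ∈ S, coarse Q (c + v) ∈ A := by
  simp only [placements, Finset.mem_biUnion, Finset.mem_image]
  constructor
  · rintro ⟨v, hv, x, hx, rfl⟩
    refine ⟨v, hv, ?_⟩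
    rwa [sub_add_cancel, ← mem_blockFibres hQ]
  · rintro ⟨v, hv, h⟩
    exact ⟨v, hv, c + v, (mem_blockFibres hQ).2 h, add_sub_cancel_right c v⟩

/-- **`#placements ≤ #S · Q^d · #A`** (union bound over the pattern, translation is injective, `card_blockFibres`).
[folklore] -/
theorem card_placements_le {Q : ℕ} (hQ : 0 < Q) (S A : Finset (Pt d)) :
    (placements Q S A).card ≤ S.card * (Q ^ d * A.card) := by
  refine Finset.card_biUnion_le.trans ((Finset.sum_le_sum fun v _ => Finset.card_image_le).trans ?_)
  simp [card_blockFibres hQ]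

/-! ## §3 Touching through the S-operation -/

/-- Sup-distance balls are symmetric: `y ∈ box c r ↔ c ∈ box y r`. [folklore] -/
theorem mem_box_comm {c y : Pt d} {r : ℕ} : y ∈ box c r ↔ c ∈ box y r := by
  simp only [mem_box]
  exact forall_congr' fun i => by constructor <;> rintro ⟨h1, h2⟩ <;> constructor <;> linarith

/-- A cube within sup-distance `r` of a cube of `T` lies in `collar^[r] T` (`B16Absorption.box_subset_iterate_collar`,
`B16SProfile.iterate_collar_mono`). [folklore] -/
theorem mem_iterate_collar_of_mem_box {T : Finset (Pt d)} {y c : Pt d} {r : ℕ} (hy : y ∈ T) (hc : c ∈ box y r) :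
    c ∈ collar^[r] T :=
  iterate_collar_mono r (Finset.singleton_subset_iff.2 hy) (box_subset_iterate_collar y r hc)

/-- **TOUCHING THROUGH THE S-OPERATION**: along a flow pattern `q = ratio L σ` under the drop control (`L ≥ 3`,
`a ≤ m`), if the `a`-th iterate `S^{a}(P)` MEETS a target `T` (both on the step-`a` lattice), then some cube `p ∈ P`
blocks into the `31`-layer collar of `T`: `coarse Q_a p ∈ collar^[31] T` — every cube of `S^{a}(P)` is within
sup-distance `31` of `⌊p/Q_a⌋` for some `p ∈ P` (`B16SProfile.Siter_subset_biUnion_box`).  Context: mergers join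
domains whose `S`-images touch, [Balaban1989LargeFieldII] (1.86) p. 386 (NOT asserted). [folklore] -/
theorem exists_coarse_mem_of_Siter_meets {L : ℕ} {σ : ℕ → ℕ} {m a : ℕ} (hL : 3 ≤ L) (h : DropCtl σ m)
    (ha : a ≤ m) {P T : Finset (Pt d)} (hPT : (Siter (ratio L σ) a P ∩ T).Nonempty) :
    ∃ p ∈ P, coarse (Qprod (ratio L σ) a) p ∈ collar^[31] T := by
  obtain ⟨y, hy⟩ := hPT
  rw [Finset.mem_inter] at hy
  have h1 := Siter_subset_biUnion_box hL h P ha hy.1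
  rw [Finset.mem_biUnion] at h1
  obtain ⟨c, hc, hyc⟩ := h1
  simp only [closureIdx, Finset.mem_image] at hc
  obtain ⟨p, hp, rfl⟩ := hc
  exact ⟨p, hp, mem_iterate_collar_of_mem_box hy.2 (mem_box_comm.1 hyc)⟩

/-- The translated pattern `c + S` as a finite set of fine cubes. [folklore] -/
def shift (c : Pt d) (S : Finset (Pt d)) : Finset (Pt d) := S.image fun v => c + v

/-- Membership in the translated pattern. [folklore] -/
theorem mem_shift {c : Pt d} {S : Finset (Pt d)} {p : Pt d} : p ∈ shift c S ↔ ∃ v ∈ S, c + v = p := by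
  simp only [shift, Finset.mem_image]

/-- **THE TOUCHING PLACEMENTS OF A PATTERN ARE FEW**: in any finite universe `U` of root cells, those `c` whose
translated pattern's `a`-th `S`-iterate meets the target `T` number `≤ #S · Q_a^d · #collar^[31] T`.  This is the
geometric half of the merger multiplicity for ONE merger: root cell of the later-born partner (pattern `S` = its birth
region about its root, born `a` steps before the merger) against the target `T` (the merger-step image of the other
partner). [folklore] -/
theorem card_touching_le {L : ℕ} {σ : ℕ → ℕ} {m a : ℕ} (hL : 3 ≤ L) (h : DropCtl σ m) (ha : a ≤ m)
    (S T U : Finset (Pt d)) :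
    (U.filter fun c => (Siter (ratio L σ) a (shift c S) ∩ T).Nonempty).card
      ≤ S.card * (Qprod (ratio L σ) a ^ d * (collar^[31] T).card) := by
  have hQ : 0 < Qprod (ratio L σ) a := Qprod_pos (fun l => ratio_pos (by omega) σ l) a
  refine le_trans (Finset.card_le_card fun c hc => ?_) (card_placements_le hQ S _)
  obtain ⟨p, hp, hpT⟩ := exists_coarse_mem_of_Siter_meets hL h ha (Finset.mem_filter.1 hc).2
  obtain ⟨v, hv, rfl⟩ := mem_shift.1 hp
  exact (mem_placements hQ).2 ⟨v, hv, hpT⟩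

/-- `B16MergeGeometry.Touch a c` (the tree's «domains intersect, or touch each other»; the merger hypothesis of
`B16MergeHorizon` Part 5) is membership in the one-layer block: `Touch a c ↔ c ∈ block a`. [folklore] -/
theorem touch_iff_mem_block {a c : Pt d} : B16MergeGeometry.Touch a c ↔ c ∈ block a := by
  rw [mem_block]
  exact forall_congr' fun i => by constructor <;> rintro ⟨h1, h2⟩ <;> constructor <;> linarith

/-- Two cube sets touch iff the second meets the one-layer collar of the first. [folklore] -/
theorem exists_touch_iff_meets_collar {A B : Finset (Pt d)} :
    (∃ a ∈ A, ∃ c ∈ B, B16MergeGeometry.Touch a c) ↔ (B ∩ collar A).Nonempty := by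
  constructor
  · rintro ⟨a, ha, c, hc, hac⟩
    exact ⟨c, Finset.mem_inter.2 ⟨hc, mem_collar.2 ⟨a, ha, touch_iff_mem_block.1 hac⟩⟩⟩
  · rintro ⟨c, hc⟩
    obtain ⟨hcB, hcA⟩ := Finset.mem_inter.1 hc
    obtain ⟨a, ha, hca⟩ := mem_collar.1 hcA
    exact ⟨a, ha, c, hcB, touch_iff_mem_block.2 hca⟩

open scoped Classical in
/-- **THE MERGER-TRIGGER FORM**: the root cells `c` whose translated pattern's `a`-th `S`-iterate TOUCHES the other
partner's step-`a` image `X` (a pair of cubes at sup-distance `≤ 1`) number `≤ #S · Q_a^d · #collar^[32] X`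
(`card_touching_le` with `T = collar X`). [folklore] -/
theorem card_touchingT_le {L : ℕ} {σ : ℕ → ℕ} {m a : ℕ} (hL : 3 ≤ L) (h : DropCtl σ m) (ha : a ≤ m)
    (S X U : Finset (Pt d)) :
    (U.filter fun c => ∃ x ∈ X, ∃ y ∈ Siter (ratio L σ) a (shift c S), B16MergeGeometry.Touch x y).card
      ≤ S.card * (Qprod (ratio L σ) a ^ d * (collar^[32] X).card) := by
  have h1 := card_touching_le hL h ha S (collar X) U
  rw [show collar^[31] (collar X) = collar^[32] X from (Function.iterate_succ_apply collar 31 X).symm] at h1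
  refine le_trans (Finset.card_le_card fun c hc => ?_) h1
  rw [Finset.mem_filter] at hc ⊢
  exact ⟨hc.1, exists_touch_iff_meets_collar.1 hc.2⟩

/-- A target covered by pieces is priced piece by piece: `T ⊆ ⋃_b Z_b ⇒ #collar^[n] T ≤ Σ_b #collar^[n] Z_b`
(`B16SProfile.iterate_collar_mono`, `iterate_collar_biUnion`). [folklore] -/
theorem card_iterate_collar_le_sum {ι : Type*} (s : Finset ι) (Zf : ι → Finset (Pt d)) {T : Finset (Pt d)}
    (hT : T ⊆ s.biUnion Zf) (n : ℕ) : (collar^[n] T).card ≤ ∑ b ∈ s, (collar^[n] (Zf b)).card := by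
  refine (Finset.card_le_card (iterate_collar_mono n hT)).trans ?_
  rw [iterate_collar_biUnion]
  exact Finset.card_biUnion_le

/-- Extra layers about a zone are a wider zone: `collar^[n] ((S^{i}(Z))^{~r}) = (S^{i}(Z))^{~(n+r)}`. [folklore] -/
theorem iterate_collar_zone (q : ℕ → ℕ) (n r i : ℕ) (Z : Finset (Pt d)) :
    collar^[n] (zone q r i Z) = zone q (n + r) i Z := by
  unfold zone
  rw [Function.iterate_add_apply]

/-- **ONE MERGER AGAINST ONE LIVE PIECE, END TO END**: partner pattern `S` born `a` steps before the merger along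
`ratio L σ` (drop control `DropCtl σ m`, `a ≤ m`); target = the zone `(S^{i}(Z))^{~r}` of a live piece `Z` (non-empty,
face-connected) of the other partner, `i` steps old at the merger along ITS flow `ratio L τ` (`DropCtl τ m'`, `i ≤ m'`,
`L ≥ 4`).  The touching root cells number `≤ #S · Q_a^d · siteConst d (31 + r) · (1 + d′(Z)·2^{−i})`
(`card_touching_le`, `iterate_collar_zone`, `T4EntropyShapeInstances.card_zone_le`): pattern volume × FIBRE × shrinking
site count.  The volume `#S ≤ 2^d (4 d′(S) + 1)` (`TreeLength.card_le_treeLen`) and `(1 + x) ≤ e^x` turn the two outer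
factors into tree-decay debits of the two partners' birth events; the fibre `Q_a^d` is priced in §4. [folklore] -/
theorem card_touching_zone_le {L : ℕ} {σ τ : ℕ → ℕ} {m m' a i : ℕ} (hL : 4 ≤ L) (h : DropCtl σ m) (ha : a ≤ m)
    (h' : DropCtl τ m') (hi : i ≤ m') {Z : Finset (Pt d)} (hZ : Z.Nonempty) (hZc : FaceConnected Z) (r : ℕ)
    (S U : Finset (Pt d)) :
    ((U.filter fun c => (Siter (ratio L σ) a (shift c S) ∩ zone (ratio L τ) r i Z).Nonempty).card : ℝ)
      ≤ S.card * Qprod (ratio L σ) a ^ d * (siteConst d (31 + r) * (1 + treeLen Z * (1 / 2 : ℝ) ^ i)) := by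
  have hL3 : 3 ≤ L := by omega
  have h1 := card_touching_le hL3 h ha S (zone (ratio L τ) r i Z) U
  rw [iterate_collar_zone] at h1
  have h2 := card_zone_le hL h' hZ hZc hi (31 + r)
  have h3 : ((U.filter fun c => (Siter (ratio L σ) a (shift c S) ∩ zone (ratio L τ) r i Z).Nonempty).card : ℝ)
      ≤ S.card * Qprod (ratio L σ) a ^ d * ((zone (ratio L τ) (31 + r) i Z).card : ℝ) := by
    have := h1
    push_cast [mul_assoc] at this ⊢
    exact_mod_cast h1
  have h4 : (0 : ℝ) ≤ S.card * Qprod (ratio L σ) a ^ d := by positivity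
  exact h3.trans (mul_le_mul_of_nonneg_left h2 h4)

/-! ## §4 The exponent, exactly -/

/-- **THE FIBRE EXPONENT, EXACTLY**: along `ratio L σ` under the drop control, `Q_a^d · (L^{σ 0})^d = (L^d)^a · (L^{σ a})^d`
— in print's letters `Q_a^d · R_0^d = Λ^a · R_a^d` (`Λ = L^d`, `R_n = L^{σ n}`; `B16SProfile.Qprod_ratio_mul_pow`). [folklore] -/
theorem Qprod_pow_mul {L : ℕ} {σ : ℕ → ℕ} {m a : ℕ} (h : DropCtl σ m) (ha : a ≤ m) :
    Qprod (ratio L σ) a ^ d * (L ^ σ 0) ^ d = (L ^ d) ^ a * (L ^ σ a) ^ d := by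
  rw [← mul_pow, Qprod_ratio_mul_pow L h a ha, pow_add, mul_pow, ← pow_mul, ← pow_mul L d a, mul_comm a d]

/-- **UPPER BOUND, ALWAYS**: `Q_a^d ≤ Λ^a · R_a^d` (`L ≥ 1`) — the LOCATED EXCESS over `Λ^a` is at most the `d`-th power
of the size factor at the merger step. [folklore] -/
theorem Qprod_pow_le {L : ℕ} (hL : 0 < L) {σ : ℕ → ℕ} {m a : ℕ} (h : DropCtl σ m) (ha : a ≤ m) :
    Qprod (ratio L σ) a ^ d ≤ (L ^ d) ^ a * (L ^ σ a) ^ d := by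
  calc Qprod (ratio L σ) a ^ d ≤ Qprod (ratio L σ) a ^ d * (L ^ σ 0) ^ d :=
        Nat.le_mul_of_pos_right _ (by positivity)
    _ = (L ^ d) ^ a * (L ^ σ a) ^ d := Qprod_pow_mul h ha

/-- **NO EXCESS WHEN THE SIZE EXPONENT DID NOT GROW**: `σ a ≤ σ 0 ⇒ Q_a^d ≤ Λ^a`. [folklore] -/
theorem Qprod_pow_le_of_le {L : ℕ} (hL : 0 < L) {σ : ℕ → ℕ} {m a : ℕ} (h : DropCtl σ m) (ha : a ≤ m)
    (hσ : σ a ≤ σ 0) : Qprod (ratio L σ) a ^ d ≤ (L ^ d) ^ a := by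
  have h1 := Qprod_pow_mul (L := L) (d := d) h ha
  have h2 : (L ^ σ a) ^ d ≤ (L ^ σ 0) ^ d := Nat.pow_le_pow_left (Nat.pow_le_pow_right hL hσ) d
  have h3 : Qprod (ratio L σ) a ^ d * (L ^ σ 0) ^ d ≤ (L ^ d) ^ a * (L ^ σ 0) ^ d :=
    h1 ▸ Nat.mul_le_mul_left _ h2
  exact Nat.le_of_mul_le_mul_right h3 (by positivity)

/-- **THE UNIFORM CELL MODEL**: constant size exponents `σ ≡ s` give the ratio `L` at every step
(`B16Absorption.ratio_const`), `Q_a = L^a`, and the fibre `Q_a^d = (L^d)^a = Λ^a` ON THE NOSE — the `Λ` of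
`T4PersistentHistoryCount.card_torusCells` (`#cells(step j) = ℓ^d · (L^d)^{K−j}`). [folklore] -/
theorem Qprod_pow_const (L s a : ℕ) : Qprod (ratio L fun _ => s) a ^ d = (L ^ d) ^ a := by
  rw [ratio_const]
  have : Qprod (fun _ : ℕ => L) a = L ^ a := by
    induction a with
    | zero => simp
    | succ n ih => rw [Qprod_succ, ih, pow_succ]
  rw [this, ← pow_mul, ← pow_mul, mul_comm]

/-! ## §5 Path independence of the fibre factor -/

/-- **PATH INDEPENDENCE** `Q_{a+b} = Q_a · Q′_b` with `Q′` the accumulated ratio of the SHIFTED sequence `l ↦ q (a + l)`: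
re-rooting a chain of blockings at an intermediate step does not change the total fibre factor (with
`blockFibres_blockFibres`: nor the fibre itself). [folklore] -/
theorem Qprod_add (q : ℕ → ℕ) (a b : ℕ) : Qprod q (a + b) = Qprod q a * Qprod (fun l => q (a + l)) b := by
  induction b with
  | zero => simp
  | succ n ih => rw [← add_assoc, Qprod_succ, ih, Qprod_succ, mul_assoc]

/-- … in particular the composite fibre over a set of step-`(a+b)` cubes has `Q_{a+b}^d · #B` fine cubes whichever way it
is re-rooted. [folklore] -/
theorem card_blockFibres_add {q : ℕ → ℕ} (hq : ∀ l, 0 < q l) (a b : ℕ) (B : Finset (Pt d)) :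
    (blockFibres (Qprod q a) (blockFibres (Qprod (fun l => q (a + l)) b) B)).card = Qprod q (a + b) ^ d * B.card := by
  rw [blockFibres_blockFibres (Qprod_pos hq a) (Qprod_pos (fun l => hq (a + l)) b), ← Qprod_add,
    card_blockFibres (Qprod_pos hq (a + b))]

/-! ## §6 The link to `partnerAges`, and decided sanity instances -/

section Link

variable {ε : Type*}

/-- **THE PER-MERGER EXPONENT IS THE AGE PLUS ONE**: for a merger by `e` of two bare births, the later at step `s′`, the
exponent `T4PartnerMultiplicity.partnerAges` books `st e + 1 − s′` — the `a + 1` of §3–§4 with `a = st e − s′` (the `+1`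
is the merger block itself: `Q_{a+1} = Q_a · q_a`, `Qprod_succ`). [folklore] -/
theorem partnerAges_merge_born (st : ε → ℕ) (b b' e : ε) (j j' : ℕ) :
    partnerAges st (Gen.merge (Gen.born b j) (Gen.born b' j') e) = st e + 1 - max j j' := by
  simp [partnerAges, Gen.rootStep]

end Link

namespace Sanity

/-- `d = 1`, `Q = 3`: the fibre over the cube `2` is `{6, 7, 8}`. [folklore] -/
theorem fibre_d1 : (blockFibre (d := 1) 3 fun _ => 2) = Fintype.piFinset fun _ => Finset.Ico (6 : ℤ) 9 := by
  unfold blockFibre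
  norm_num

/-- `d = 2`, `Q = 5`, two target cubes: the preimage has `5^2 · 2 = 50` fine cubes. [folklore] -/
theorem fibres_d2 : (blockFibres (d := 2) 5 {(fun _ => 0), (fun _ => 1)}).card = 50 := by
  rw [card_blockFibres (by norm_num)]
  decide

/-- The uniform model at `L = 2`, `d = 4`, age `3`: fibre `(2^4)^3 = 4096 = Λ^3`. [folklore] -/
theorem uniform_d4 : Qprod (ratio 2 fun _ => 7) 3 ^ 4 = 4096 := by
  rw [Qprod_pow_const]; norm_num

/-- A growing size exponent DOES produce an excess: `L = 2`, `σ = (0, 1)`, one step: `q_0 = L^{σ 1 + 1 − σ 0} = 4`,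
so `Q_1^d = 4^d > Λ^1 = 2^d` (`d = 1`: `4 > 2`) — the located excess `(R_1/R_0)^d = 2^d` of §4 is real. [folklore] -/
theorem excess_witness : Qprod (ratio 2 fun n => if n = 0 then 0 else 1) 1 ^ 1 = 4 ∧ (2 ^ 1) ^ 1 = 2 := by
  refine ⟨?_, by norm_num⟩
  simp [Qprod_succ, ratio, qexp]

end Sanity

end

end Summit.QuantumFields.BalabanUV.T4Continuum.PartnerPlacement
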